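import Literature.AnabelianGeometry.AbsoluteAnabelian.AbsTopIThm26iiiClauseOneOpen
import Literature.AnabelianGeometry.AbsoluteAnabelian.AbsTopIAlmostProSigmaBridge
import Literature.NumberTheory.GaloisRepresentations.Corestriction
import HarnessLib

/-!
# [AbsTopI] Thm 2.6 (iii), first clause `θ²(Π) ⊆ Σ`, for a `Δ` that is only ALMOST pro-`Σ` (the Def 2.1 (i) datum)

S. Mochizuki, *Topics in Absolute Anabelian Geometry I: Generalities* (2012) [AbsTopI] (lit key
`paper:url-11ac98ba15fc`), Def 1.1 (iii) p. 10, Def 2.1 (i) p. 17 ("`π₁(X_k̄) ↠ Δ_X` an ALMOST pro-`Σ`-maximal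
quotient"), Thm 2.6 (iii) p. 22 and its proof p. 23 ("`δ²_l(H) = 0` if `l ∉ Σ` … this already implies that
`θ²(Π) ⊆ Σ`"); J.-P. Serre, *Galois Cohomology*, I §2.4 Prop. 9 (`cor ∘ res = (G : S)`).

PROOF-ONLY file (abc-iut-w6-d071, L4 row «THM26-ALMOST-PROSIGMA», file 3; no definition, no named fact).  The
landed proof of the first clause (abc-iut-w6-d073 lineage, `AbsTopIThm26iiiClauseOneProofs.lean`:
`thetaSet_two_subset_of_isProSet`) takes `Δ` PRO-`Σ` and uses it ESSENTIALLY — every open normal subgroup of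
`N = Δ ∩ J` must have index prime to `l ∉ Σ` so that `H¹ = H² = 0` for `(N, ℤ/lⁱ)`; for `Δ` only ALMOST pro-`Σ` (open
pro-`Σ` subgroup `U`) that fails (census 2026-08-26T12:2xZ).  THE REPAIR, as print's `ℚ_l`-statement predicts: for
an open `J ≤ Π` choose an open subgroup `Π₀ ≤ Π` with `Δ ∩ Π₀ ⊆ U` (`U = Δ ∩ O` for an open `O ⊆ Π`, which contains an
open subgroup); for `J′ := J ∩ Π₀` the geometric part `Δ ∩ J′` IS pro-`Σ`, so the landed inflation step kills
`H²(J′, ℤ/lⁱ)` by one `m` independent of `i`; and `cor ∘ res = [J : J′]` on `H²(J, ℤ/lⁱ)` (the tree's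
`Literature.NumberTheory.GaloisRepresentations.cor_resH`, corestriction in all degrees for a closed subgroup of a
profinite group and a discrete module) shows `[J : J′]·m` kills `H²(J, ℤ/lⁱ)`; with `H¹(J, ℤ/lⁱ)` finite (`Π` tfg) this
gives `H²_cont(J, ℚ_l) = 0`, i.e. `δ²_l(J) = 0`, hence `ε²_l(Π) = 0` and `θ²(Π) ⊆ Σ`.

* `nsmul_continuousCohomology_two_zmod_eq_zero_of_isProSet_subgroupOf` — the inflation step of the landed file
  re-keyed on «`Δ ∩ J` pro-`Σ`» (instead of «`Δ` pro-`Σ`»);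
* `exists_nsmul_continuousCohomology_two_zmod_of_isProSet_subgroupOf` — uniform torsion of `H²(J, ℤ/lⁱ)` for such
  `J`;
* `nsmul_continuousCohomology_two_zmod_of_subgroup` — **the corestriction step**: an integer killing
  `H²(J′, ℤ/lⁱ)` for an open `J′ ≤ J` gives `[J : J′]` times it killing `H²(J, ℤ/lⁱ)`;
* `exists_isOpen_isProSet_geom_subgroupOf_of_isAlmostPro` — for `Δ` almost pro-`Σ` there is an open `Π₀ ≤ Π` such
  that `Δ ∩ J′` is pro-`Σ` for every open `J′ ≤ Π₀`;
* **`deltaInv_two_eq_zero_of_isAlmostPro`**, **`thetaSet_two_subset_of_isAlmostPro`** — Thm 2.6 (iii) clause 1 for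
  `Δ` ALMOST pro-`Σ`.

HONEST SCOPE: clause 1 only (clause 2 = Lemma 2.7 (iii) input, untouched); refereed, undisputed statement; classical
Galois cohomology on top of landed files; OUR kernel check; nothing here bears on [IUTchIII] Cor. 3.12.
-/

noncomputable section

open CategoryTheory Function Topology

namespace Literature.AnabelianGeometry.AbsoluteAnabelian

open Literature.NumberTheory.GaloisRepresentations
open _root_.TopRep _root_.ContRepresentation _root_.ContinuousCohomology Field LocalWeilDatum

/-! ### Private plumbing (copies of private lemmas of the landed clause-one file) -/

/-- The restriction of a trivial representation to a subgroup is the trivial representation. [folklore] -/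
private theorem trivial_restrict_subgroupIncl_copy {G : Type} [Group G] [TopologicalSpace G]
    (N : Subgroup G) (A : Type) [AddCommGroup A] [TopologicalSpace A] :
    (ContinuousRep.trivial G ℤ A).restrict (subgroupIncl N) = ContinuousRep.trivial ↥N ℤ A :=
  ContinuousRep.ext fun _ => rfl

/-- `ContinuousCohomology.map` along the identity with identity coefficients is the identity. [folklore] -/
private theorem continuousCohomology_map_eq_id_copy {k : Type*} [Ring k] [TopologicalSpace k]
    {H : Type} [Group H] [TopologicalSpace H] [IsTopologicalGroup H]
    {X : TopRep k H} (θ : H →ₜ* H) (F : TopRep.res (θ : H →* H) X ⟶ X)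
    (hθ : θ = ContinuousMonoidHom.id H) (hF : ∀ x : X, F.hom x = x) (q : ℕ) :
    ContinuousCohomology.map θ F q = 𝟙 _ := by
  subst hθ
  have : F = 𝟙 X :=
    TopRep.hom_ext (ContIntertwiningMap.ext (ContinuousLinearMap.ext fun x => hF x))
  rw [this]
  exact ContinuousCohomology.map_id X q

/-- If `X` (over `G`) and `Y` (over `H`) correspond under `e : G ≃ₜ* H` (`ψ ∘ φ = id`), an integer
killing `Hⁿ(H, Y)` kills `Hⁿ(G, X)`. [folklore] -/
private theorem nsmul_continuousCohomology_eq_zero_of_continuousMulEquiv_copy {G H : Type} [Group G]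
    [TopologicalSpace G] [IsTopologicalGroup G] [Group H] [TopologicalSpace H] [IsTopologicalGroup H]
    (e : G ≃ₜ* H) {X : TopRep.{0} ℤ G} {Y : TopRep.{0} ℤ H}
    (φ : TopRep.res ((e.symm : H →ₜ* G) : H →* G) X ⟶ Y)
    (ψ : TopRep.res ((e : G →ₜ* H) : G →* H) Y ⟶ X)
    (hψφ : ∀ x : X, ψ.hom (φ.hom x) = x) (n : ℕ) {m : ℕ}
    (hm : ∀ y : continuousCohomology n Y, m • y = 0) (x : continuousCohomology n X) : m • x = 0 := by
  have hcomp : ContinuousCohomology.map (e.symm : H →ₜ* G) φ n ≫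
      ContinuousCohomology.map (e : G →ₜ* H) ψ n = 𝟙 _ := by
    rw [← ContinuousCohomology.map_comp]
    exact continuousCohomology_map_eq_id_copy _ _ (by ext g; simp) (fun x => hψφ x) n
  have hx : (ContinuousCohomology.map (e : G →ₜ* H) ψ n).hom
      ((ContinuousCohomology.map (e.symm : H →ₜ* G) φ n).hom x) = x := by
    have h := congr_arg (fun f => f.hom x) hcomp
    simpa using h
  rw [← hx, ← map_nsmul, hm, map_zero]

namespace FundamentalExtension

variable (E : FundamentalExtension.{0})

/-! ### The inflation step, re-keyed on «`Δ ∩ J` pro-`Σ`» -/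

/-- **Inflation step over a `J` whose geometric part is pro-`Σ`.**  For `J ≤ Π` open with `Δ ∩ J` pro-`Σ`
(`IsProSet ↥(Δ.subgroupOf J) S`), `l ∉ Σ` prime and `N = Δ ∩ J`: `H¹(N, ℤ/lⁱ) = H²(N, ℤ/lⁱ) = 0` (every open normal
subgroup of `N` has index prime to `l`), so an integer killing `H²(J/N, (ℤ/lⁱ)^N)` kills `H²(J, ℤ/lⁱ)`.  (The landed
`nsmul_continuousCohomology_two_zmod_eq_zero_of_quotient` with its hypothesis «`Δ` pro-`Σ`» weakened to what it
uses.) [cite: MochizukiAbsTopI2012, Thm 2.6 (iii) proof p.23] -/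
theorem nsmul_continuousCohomology_two_zmod_eq_zero_of_isProSet_subgroupOf {S : Set ℕ}
    {J : Subgroup E.arith} (hJ : IsOpen (J : Set E.arith)) (hN : IsProSet ↥(E.geom.subgroupOf J) S)
    {l : ℕ} [hl : Fact l.Prime] (hlS : l ∉ S) (i : ℕ) {m : ℕ}
    (hm : ∀ w : continuousCohomology 2 (((ContinuousRep.trivial ↥J ℤ (ZMod (l ^ i))).quotientInvariants
      (E.geom.subgroupOf J))).toTopRep, m • w = 0)
    (x : continuousCohomology 2 (ContinuousRep.trivial ↥J ℤ (ZMod (l ^ i))).toTopRep) : m • x = 0 := by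
  haveI : IsClosed (J : Set E.arith) := Subgroup.isClosed_of_isOpen J hJ
  haveI : CompactSpace ↥J := isCompact_iff_compactSpace.1 (Subgroup.isClosed_of_isOpen J hJ).isCompact
  haveI : (E.geom.subgroupOf J).Normal := E.normal_geom.subgroupOf J
  have hNc : IsClosed ((E.geom.subgroupOf J : Subgroup ↥J) : Set ↥J) :=
    E.isClosed_geom.preimage continuous_subtype_val
  haveI : IsClosed ((E.geom.subgroupOf J : Subgroup ↥J) : Set ↥J) := hNc
  haveI : CompactSpace ↥(E.geom.subgroupOf J) := isCompact_iff_compactSpace.1 hNc.isCompact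
  have hcop : ∀ U : Subgroup ↥(E.geom.subgroupOf J), U.Normal →
      IsOpen (U : Set ↥(E.geom.subgroupOf J)) → U.index.Coprime l := fun U hUn hU =>
    Nat.Coprime.symm ((Nat.Prime.coprime_iff_not_dvd hl.out).mpr fun hdvd =>
      hlS (hN.prime_dvd_index U hUn hU l hl.out hdvd))
  have h1 : Subsingleton (continuousCohomology 1 (((ContinuousRep.trivial ↥J ℤ (ZMod (l ^ i))).restrict
      (subgroupIncl (E.geom.subgroupOf J)))).toTopRep) := by
    rw [trivial_restrict_subgroupIncl_copy]
    exact subsingleton_continuousCohomology_one_zmod_of_coprime_index l i hcop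
  have h2 : Subsingleton (continuousCohomology 2 (((ContinuousRep.trivial ↥J ℤ (ZMod (l ^ i))).restrict
      (subgroupIncl (E.geom.subgroupOf J)))).toTopRep) := by
    rw [trivial_restrict_subgroupIncl_copy]
    exact subsingleton_continuousCohomology_two_zmod_of_coprime_index l i hcop
  obtain ⟨w, hw⟩ := exists_inf_two_eq_of_resH_eq_zero (E.geom.subgroupOf J)
    (ContinuousRep.trivial ↥J ℤ (ZMod (l ^ i))) h1 x (Subsingleton.elim _ _)
  rw [← hw, ← map_nsmul, hm, map_zero]

/-- **Uniform torsion of `H²(J, ℤ/lⁱ)` when `Δ ∩ J` is pro-`Σ`** (MLF base data, `l ∉ Σ`): one `m > 0` with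
`m • H²(J, ℤ/lⁱ) = 0` for all `i` — `J/(Δ ∩ J) ≅ G_{K′}` (`exists_quotient_continuousMulEquiv_absoluteGaloisGroup`),
"`δ²_l(G_{K′}) = 0`" in torsion form (`exists_nsmul_continuousCohomology_two_zmod_eq_zero`) and the inflation step.
[cite: MochizukiAbsTopI2012, Thm 2.6 (iii) proof p.23] -/
theorem exists_nsmul_continuousCohomology_two_zmod_of_isProSet_subgroupOf (B : E.MLFBase) {S : Set ℕ}
    {J : Subgroup E.arith} (hJ : IsOpen (J : Set E.arith)) (hN : IsProSet ↥(E.geom.subgroupOf J) S)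
    {l : ℕ} [hl : Fact l.Prime] (hlS : l ∉ S) :
    ∃ m : ℕ, 0 < m ∧ ∀ (i : ℕ) (x : continuousCohomology 2 (zmodRep ↥J l i)), m • x = 0 := by
  classical
  haveI : IsClosed (J : Set E.arith) := Subgroup.isClosed_of_isOpen J hJ
  haveI : CompactSpace ↥J := isCompact_iff_compactSpace.1 (Subgroup.isClosed_of_isOpen J hJ).isCompact
  haveI : (E.geom.subgroupOf J).Normal := E.normal_geom.subgroupOf J
  obtain ⟨K', hfinK', ⟨e⟩⟩ := E.exists_quotient_continuousMulEquiv_absoluteGaloisGroup B hJ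
  haveI := hfinK'
  haveI : FiniteDimensional ℚ_[B.p] ↥K' := FiniteDimensional.trans ℚ_[B.p] B.K ↥K'
  obtain ⟨m, hm0, hm⟩ := exists_nsmul_continuousCohomology_two_zmod_eq_zero B.p ↥K' l
  -- uniform torsion of `H²(J, ℤ/lⁱ)`
  refine ⟨m, hm0, ?_⟩
  show ∀ (i : ℕ) (x : continuousCohomology 2 (zmodRep ↥J l i)), m • x = 0
  · intro i x
    refine E.nsmul_continuousCohomology_two_zmod_eq_zero_of_isProSet_subgroupOf hJ hN hlS i (fun w => ?_) x
    let ρ := ContinuousRep.trivial ↥J ℤ (ZMod (l ^ i))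
    let τ := ρ.quotientInvariants (E.geom.subgroupOf J)
    let Y := (ContinuousRep.trivial (absoluteGaloisGroup ↥K') ℤ (ZMod (l ^ i))).toTopRep
    have hτ : ∀ (q : ↥J ⧸ E.geom.subgroupOf J) (v : ρ.invariantsOf (E.geom.subgroupOf J)),
        ((τ q v : ρ.invariantsOf (E.geom.subgroupOf J)) : ZMod (l ^ i)) = v := by
      intro q v
      obtain ⟨σ, rfl⟩ := QuotientGroup.mk_surjective q
      exact ContinuousRep.quotientInvariants_apply_coe (E.geom.subgroupOf J) ρ σ v
    let φ : TopRep.res ((e.symm : absoluteGaloisGroup ↥K' →ₜ* (↥J ⧸ E.geom.subgroupOf J)) :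
        absoluteGaloisGroup ↥K' →* (↥J ⧸ E.geom.subgroupOf J)) τ.toTopRep ⟶ Y :=
      TopRep.ofHom
        ⟨{ toLinearMap := (ρ.invariantsOf (E.geom.subgroupOf J)).subtype
           cont := continuous_subtype_val }, fun g => by
          refine ContinuousLinearMap.ext fun v => ?_
          exact hτ _ v⟩
    let ψ : TopRep.res ((e : (↥J ⧸ E.geom.subgroupOf J) →ₜ* absoluteGaloisGroup ↥K') :
        (↥J ⧸ E.geom.subgroupOf J) →* absoluteGaloisGroup ↥K') Y ⟶ τ.toTopRep :=
      TopRep.ofHom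
        ⟨{ toFun := fun a => ⟨a, fun _ => rfl⟩
           map_add' := fun _ _ => rfl
           map_smul' := fun _ _ => rfl
           cont := continuous_of_discreteTopology }, fun g => by
          refine ContinuousLinearMap.ext fun a => Subtype.ext ?_
          exact (hτ _ _).symm⟩
    exact nsmul_continuousCohomology_eq_zero_of_continuousMulEquiv_copy e φ ψ
      (fun v => Subtype.ext rfl) 2 (hm i) w

/-! ### The corestriction step -/

/-- **`cor ∘ res = [J : J′]` kills the torsion obstruction.**  If `J′ ≤ J` are open subgroups of `Π` and `m` kills
`H²(J′, ℤ/lⁱ)`, then `[J : J′]·m` kills `H²(J, ℤ/lⁱ)`: `[J : J′] • x = cor (res x)` (Serre I §2.4 Prop. 9, the tree's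
`cor_resH` for the profinite `J`, its closed subgroup `J′` and the discrete module `ℤ/lⁱ`) and `m • res x = 0`.
[cite: SerreGaloisCohomology1997, I §2.4 Prop. 9] -/
theorem nsmul_continuousCohomology_two_zmod_of_subgroup {J : Subgroup E.arith} (hJ : IsOpen (J : Set E.arith))
    {J' : Subgroup E.arith} (hJ' : IsOpen (J' : Set E.arith)) (hle : J' ≤ J) {l : ℕ} [Fact l.Prime]
    (i : ℕ) {m : ℕ} (hm : ∀ y : continuousCohomology 2 (zmodRep ↥J' l i), m • y = 0)
    (x : continuousCohomology 2 (zmodRep ↥J l i)) : ((J'.subgroupOf J).index * m) • x = 0 := by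
  classical
  haveI : IsClosed (J : Set E.arith) := Subgroup.isClosed_of_isOpen J hJ
  haveI : CompactSpace ↥J := isCompact_iff_compactSpace.1 (Subgroup.isClosed_of_isOpen J hJ).isCompact
  -- `S := J′` as a subgroup of `J`: open, closed, compact
  set S : Subgroup ↥J := J'.subgroupOf J with hSdef
  have hSo : IsOpen (S : Set ↥J) := by
    have : (S : Set ↥J) = Subtype.val ⁻¹' (J' : Set E.arith) := by
      ext x; simp only [hSdef, SetLike.mem_coe, Subgroup.mem_subgroupOf, Set.mem_preimage]
    rw [this]; exact hJ'.preimage continuous_subtype_val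
  have hSc : IsClosed (S : Set ↥J) := Subgroup.isClosed_of_isOpen S hSo
  haveI : IsClosed (S : Set ↥J) := hSc
  haveI : CompactSpace ↥S := isCompact_iff_compactSpace.1 hSc.isCompact
  haveI : Finite (↥J ⧸ S) := Subgroup.quotient_finite_of_isOpen S hSo
  haveI : Fintype (↥J ⧸ S) := Fintype.ofFinite _
  -- `S ≅ J′` as topological groups; transport the torsion bound to `H²(S, ℤ/lⁱ)`
  let e₀ : ↥S ≃* ↥J' := Subgroup.subgroupOfEquivOfLe hle
  let e : ↥S ≃ₜ* ↥J' :=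
    { e₀ with
      continuous_toFun := by
        refine Continuous.subtype_mk ?_ _
        exact continuous_subtype_val.comp continuous_subtype_val
      continuous_invFun := by
        refine Continuous.subtype_mk (Continuous.subtype_mk continuous_subtype_val _) _ }
  have hmS : ∀ y : continuousCohomology 2 (zmodRep ↥S l i), m • y = 0 := by
    intro y
    let X : TopRep.{0} ℤ ↥S := zmodRep ↥S l i
    let Y : TopRep.{0} ℤ ↥J' := zmodRep ↥J' l i
    let φ : TopRep.res ((e.symm : ↥J' →ₜ* ↥S) : ↥J' →* ↥S) X ⟶ Y :=
      TopRep.ofHom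
        ⟨{ toFun := fun a => a
           map_add' := fun _ _ => rfl
           map_smul' := fun _ _ => rfl
           cont := continuous_id }, fun g => by
          exact ContinuousLinearMap.ext fun a => rfl⟩
    let ψ : TopRep.res ((e : ↥S →ₜ* ↥J') : ↥S →* ↥J') Y ⟶ X :=
      TopRep.ofHom
        ⟨{ toFun := fun a => a
           map_add' := fun _ _ => rfl
           map_smul' := fun _ _ => rfl
           cont := continuous_id }, fun g => by
          exact ContinuousLinearMap.ext fun a => rfl⟩
    exact nsmul_continuousCohomology_eq_zero_of_continuousMulEquiv_copy e φ ψ (fun v => rfl) 2 hm y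
  -- the trivial representation of `J` on `ℤ/lⁱ` and its restriction to `S`
  let ρ : ContinuousRep ↥J ℤ (ZMod (l ^ i)) := ContinuousRep.trivial ↥J ℤ (ZMod (l ^ i))
  have hres : ∀ y : continuousCohomology 2 (ρ.restrict (subgroupIncl S)).toTopRep, m • y = 0 := by
    rw [trivial_restrict_subgroupIncl_copy]
    exact hmS
  -- `[J : S] • x = cor (res x)` and `m • res x = 0`
  have hcr : cor S ρ 2 (resH S ρ 2 x) = S.index • x := cor_resH S ρ 1 x
  calc (S.index * m) • x = m • (S.index • x) := by rw [mul_comm, mul_smul]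
    _ = m • cor S ρ 2 (resH S ρ 2 x) := by rw [hcr]
    _ = cor S ρ 2 (m • resH S ρ 2 x) := by rw [map_nsmul]
    _ = 0 := by rw [hres, map_zero]

/-! ### An open `Π₀ ≤ Π` over which the geometric part is pro-`Σ` -/

/-- **For `Δ` almost pro-`Σ` there is an open subgroup `Π₀ ≤ Π` such that `Δ ∩ J′` is pro-`Σ` for every open
`J′ ≤ Π₀`**: write the open pro-`Σ` subgroup `U ⊆ Δ` as `Δ ∩ O` with `O ⊆ Π` open, take an open (normal) subgroup
`Π₀ ⊆ O` (`ProfiniteGrp.exist_openNormalSubgroup_sub_open_nhds_of_one`); then `Δ ∩ J′` is (isomorphic to) an open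
subgroup of the pro-`Σ` profinite group `U`. [cite: MochizukiAbsTopI2012, Def 2.1 (i) p.17] -/
theorem exists_isOpen_isProSet_geom_subgroupOf_of_isAlmostPro {S : Set ℕ} (hpro : IsAlmostPro E.geom S) :
    ∃ P₀ : Subgroup E.arith, IsOpen (P₀ : Set E.arith) ∧
      ∀ (J : Subgroup E.arith), IsOpen (J : Set E.arith) → J ≤ P₀ → IsProSet ↥(E.geom.subgroupOf J) S := by
  haveI : CompactSpace E.geom := isCompact_iff_compactSpace.mp E.isClosed_geom.isCompact
  obtain ⟨U, hUo, hU⟩ := hpro.exists_open_pro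
  haveI : CompactSpace U := isCompact_iff_compactSpace.mp (U.isClosed_of_isOpen hUo).isCompact
  -- `U = Δ ∩ O`, `O ⊆ Π` open; an open subgroup `Π₀ ⊆ O`
  obtain ⟨O, hO, hOU⟩ := isOpen_induced_iff.mp hUo
  have h1O : (1 : E.arith) ∈ O := by
    have h : (1 : E.geom) ∈ (Subtype.val ⁻¹' O : Set E.geom) := by rw [hOU]; exact U.one_mem
    exact h
  obtain ⟨P₀, hP₀⟩ := ProfiniteGrp.exist_openNormalSubgroup_sub_open_nhds_of_one hO h1O
  refine ⟨P₀, P₀.isOpen', fun J hJ hJP => ?_⟩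
  -- membership in `U` of the geometric elements of `J`
  have hmemU : ∀ {x : E.arith} (hxΔ : x ∈ E.geom), x ∈ J → (⟨x, hxΔ⟩ : E.geom) ∈ U := by
    intro x hxΔ hxJ
    have hxO : x ∈ O := hP₀ (hJP hxJ)
    have : (⟨x, hxΔ⟩ : E.geom) ∈ (Subtype.val ⁻¹' O : Set E.geom) := hxO
    rw [hOU] at this
    exact this
  -- `Δ ∩ J` as an open subgroup `W` of `U`
  let W : Subgroup U := J.comap (E.geom.subtype.comp U.subtype)
  have hWo : IsOpen (W : Set U) := by
    have : (W : Set U) = (fun u : U => ((u : E.geom) : E.arith)) ⁻¹' (J : Set E.arith) := rfl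
    rw [this]
    exact hJ.preimage (continuous_subtype_val.comp continuous_subtype_val)
  have hW : IsProSet W S := hU.subgroup_of_isOpen hWo
  -- transport along the bicontinuous isomorphism `W ≅ Δ ∩ J` (as a subgroup of `J`)
  let f : W →ₜ* ↥(E.geom.subgroupOf J) :=
    { toFun := fun w => ⟨⟨((w : U) : E.geom), Subgroup.mem_comap.mp w.2⟩, by
        rw [Subgroup.mem_subgroupOf]; exact ((w : U) : E.geom).2⟩
      map_one' := rfl
      map_mul' := fun _ _ => rfl
      continuous_toFun := by
        refine Continuous.subtype_mk (Continuous.subtype_mk ?_ _) _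
        exact continuous_subtype_val.comp (continuous_subtype_val.comp continuous_subtype_val) }
  have hf : Function.Surjective f := by
    rintro ⟨⟨y, hyJ⟩, hy⟩
    have hyΔ : y ∈ E.geom := Subgroup.mem_subgroupOf.mp hy
    exact ⟨⟨⟨⟨y, hyΔ⟩, hmemU hyΔ hyJ⟩, Subgroup.mem_comap.mpr hyJ⟩, rfl⟩
  exact hW.of_surjective f hf

/-! ### `δ²_l(J) = 0` off `Σ` and the first clause of Thm 2.6 (iii), almost pro-`Σ` case -/

/-- **`δ²_l(J) = 0`** for every open `J ≤ Π` and every prime `l ∉ Σ`, when `G ≅ G_K` (`K` an MLF), `Π` is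
topologically finitely generated and `Δ` is ALMOST pro-`Σ` (the Def 2.1 (i) datum): `H²(J ∩ Π₀, ℤ/lⁱ)` is killed
uniformly by the inflation step, `H²(J, ℤ/lⁱ)` by corestriction, and `H¹(J, ℤ/lⁱ)` is finite.
[cite: MochizukiAbsTopI2012, Thm 2.6 (iii) proof p.23] -/
theorem deltaInv_two_eq_zero_of_isAlmostPro (B : E.MLFBase) {S : Set ℕ}
    (htfg : IsTopologicallyFinitelyGenerated E.arith) (hpro : IsAlmostPro E.geom S) {l : ℕ}
    [hl : Fact l.Prime] (hlS : l ∉ S) {J : Subgroup E.arith} (hJ : IsOpen (J : Set E.arith)) :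
    deltaInv ↥J 2 l = 0 := by
  classical
  haveI : IsClosed (J : Set E.arith) := Subgroup.isClosed_of_isOpen J hJ
  haveI : CompactSpace ↥J := isCompact_iff_compactSpace.1 (Subgroup.isClosed_of_isOpen J hJ).isCompact
  -- `Π₀` and `J′ := J ∩ Π₀`
  obtain ⟨P₀, hP₀o, hP₀⟩ := E.exists_isOpen_isProSet_geom_subgroupOf_of_isAlmostPro hpro
  set J' : Subgroup E.arith := J ⊓ P₀ with hJ'def
  have hJ'o : IsOpen (J' : Set E.arith) := by rw [hJ'def, Subgroup.coe_inf]; exact hJ.inter hP₀o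
  have hN : IsProSet ↥(E.geom.subgroupOf J') S := hP₀ J' hJ'o inf_le_right
  -- uniform torsion on `J′`, then on `J` by corestriction
  obtain ⟨m, hm0, hm⟩ := E.exists_nsmul_continuousCohomology_two_zmod_of_isProSet_subgroupOf B hJ'o hN hlS
  haveI : Finite (↥J ⧸ J'.subgroupOf J) := by
    refine Subgroup.quotient_finite_of_isOpen _ ?_
    have : ((J'.subgroupOf J : Subgroup ↥J) : Set ↥J) = Subtype.val ⁻¹' (J' : Set E.arith) := by
      ext x; simp only [SetLike.mem_coe, Subgroup.mem_subgroupOf, Set.mem_preimage]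
    rw [this]; exact hJ'o.preimage continuous_subtype_val
  haveI : (J'.subgroupOf J).FiniteIndex := Subgroup.finiteIndex_of_finite_quotient
  set M : ℕ := (J'.subgroupOf J).index * m with hMdef
  have hM0 : 0 < M := Nat.mul_pos (Nat.pos_of_ne_zero Subgroup.FiniteIndex.index_ne_zero) hm0
  have hMJ : ∀ (i : ℕ) (x : continuousCohomology 2 (zmodRep ↥J l i)), M • x = 0 := fun i x =>
    E.nsmul_continuousCohomology_two_zmod_of_subgroup hJ hJ'o inf_le_left i (hm i) x
  -- finiteness of `H¹(J, ℤ/lⁱ)` and the passage to `ℚ_l`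
  have htfgJ : IsTopologicallyFinitelyGenerated ↥J := htfg.subgroup_isOpen J hJ
  haveI : NeZero l := ⟨hl.out.ne_zero⟩
  have hfin : ∀ i, Finite (continuousCohomology 1 (zmodRep ↥J l i)) := fun i =>
    finite_continuousCohomology_one_zmod_of_tfg htfgJ l i
  haveI := subsingleton_continuousCohomology_two_padic_of_forall_zmod (G := ↥J) l hfin hM0 hMJ
  unfold deltaInv
  rw [rank_subsingleton', map_zero]

/-- **[AbsTopI] Thm 2.6 (iii), first clause `θ²(Π) ⊆ Σ`, for `Δ` ALMOST pro-`Σ`** — `G ≅ G_K` (`K` an MLF), `Π`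
topologically finitely generated (Thm 2.6 (ii)), `Δ` almost pro-`Σ` (Def 2.1 (i) / Def 1.1 (iii)): the first conjunct
of the typed `E.Thm26iii S` at the honest construction datum. [cite: MochizukiAbsTopI2012, Thm 2.6 (iii) p.22] -/
theorem thetaSet_two_subset_of_isAlmostPro (B : E.MLFBase) {S : Set ℕ}
    (htfg : IsTopologicallyFinitelyGenerated E.arith) (hpro : IsAlmostPro E.geom S) :
    thetaSet E.arith 2 ⊆ {l ∈ S | l.Prime} := by
  intro l hl
  obtain ⟨hlp, hle⟩ := hl
  refine ⟨?_, hlp⟩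
  by_contra hlS
  haveI : Fact l.Prime := ⟨hlp⟩
  have h0 : epsilonInv E.arith 2 l = 0 := by
    refine nonpos_iff_eq_zero.mp ?_
    unfold epsilonInv
    refine iSup₂_le fun J hJ => ?_
    rw [E.deltaInv_two_eq_zero_of_isAlmostPro B htfg hpro hlS hJ]
  have h1 : ((3 - 2 : ℕ) : ℕ∞) ≤ 0 := h0 ▸ hle
  norm_num at h1

end FundamentalExtension

end Literature.AnabelianGeometry.AbsoluteAnabelian

end
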